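import Mathlib.FieldTheory.Finite.Basic
import Mathlib.RingTheory.MvPolynomial.Basic
import Literature.RepresentationTheory.FiniteGroups.GL2ModularPrincipalSeriesIntertwiner
import Literature.RepresentationTheory.FiniteGroups.GL2ModularPrincipalSeriesSocle
import HarnessLib

/-!
# The mod-`p` principal series of `GL₂(𝔽_p)` is uniserial of length two:
# `0 ⊂ Sym^r ⊗ χ₁∘det ⊂ Ind_B^{GL₂(𝔽_p)}(χ₁ ⊗ χ₁ε^r)` with quotient `Sym^{p−1−r} ⊗ χ₂∘det` (`0 < r < p − 1`)

Topic `Literature/RepresentationTheory/FiniteGroups`, namespace `Literature.RepresentationTheory.FiniteGroups.GL2`.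
THEOREMS ONLY (no definition, no named fact, no instance, no notation, no `sorry`); assembles the socle theorem
(Coefficient note: the defining file `GL2ModularPrincipalSeries` now allows any commutative coefficient ring — the integral structure `Fun_R(Ind(χ₁ ⊗ χ₂))` of `GL2ModularPrincipalSeriesBruhatBasis` / `…Reduction` —; this file keeps `k` a field.)
(`GL2ModularPrincipalSeriesSocle`: `soc 𝓑(χ₁, χ₂) = Sym^r ⊗ χ₁∘det`, simple, for `χ₁ ≠ χ₂ = χ₁ε^r`, `r < p`) and
the intertwining operator `T : 𝓑(χ₁, χ₂) → 𝓑(χ₂, χ₁)` (`GL2ModularPrincipalSeriesIntertwiner`: equivariant,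
`T f₁ = f_w' ≠ 0`, `T f_w = 0`) with a dimension count.

Source: M. Emerton, T. Gee, D. Savitt, *Lattices in the cohomology of Shimura curves* [EmertonGeeSavitt2015]
§3.2 (held `paper:arxiv-1305.1594`, p0011–p0012): for `η ≠ η'`, `η η'⁻¹ = [·]^c`, «The Jordan–Hölder factors of
`σ̄(χ)` are … (see Lemma 2.2 of [Breuil–Paškūnas] or Proposition 1.1 of [Diamond])»: for `f = 1` exactly the two
factors `σ̄(χ)_∅ = Sym^c ⊗ η'∘det` and `σ̄(χ)_{{0}} = det^c Sym^{p−1−c} ⊗ η'∘det`.  Dictionary: `η' = χ₁`, `η = χ₂`,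
`c = r`, `s = p − 1 − r`; `det^r Sym^s ⊗ χ₁∘det = Sym^s ⊗ χ₂∘det` on `GL₂(𝔽_p)` since `χ₂∘det = χ₁∘det · det^r`.
D. Bump [Bump1997] §4.1 Lemma 4.1.1 for the intertwining-operator method; J. E. Humphreys [Humphreys2005] §19.2
for `dim S_n = n + 1` («all weight multiplicities are 1, since the basis monomials have distinct weights»).

## What is proved (`p` prime, `k` a field with `CharP k p`, `f = ZMod.castHom _ k`, `χ₂(a) = χ₁(a) f(a)^r`,
## `r + s = p − 1`, `χ₁ ≠ χ₂`)

* dimension bookkeeping over any finite `F`: `finrank_principalSeriesRep_le` (`dim 𝓑 ≤ #F + 1`, the `#F + 1`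
  translates of `f₁` span), `linearIndependent_monomial_binaryExponent` (the `n + 1` monomials of degree `n` are
  independent), `le_finrank_symPowSubrep` (`dim (Sym^r ⊗ χ₁∘det) ≥ r + 1` for `r < #F`);
* `rel_symm` — `χ₁(a) = χ₂(a) f(a)^s` (the roles of the two principal series are symmetric);
* **`finrank_eq_of_rel`** — `dim 𝓑(χ₁, χ₂) = p + 1`, `dim (Sym^r ⊗ χ₁∘det) = dim ker T = r + 1`,
  `dim (Sym^s ⊗ χ₂∘det) = dim im T = s + 1`;
* **`ker_and_range_intertwining`** — `ker T = Sym^r ⊗ χ₁∘det ⊂ 𝓑(χ₁, χ₂)` and `im T = Sym^s ⊗ χ₂∘det ⊂ 𝓑(χ₂, χ₁)`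
  (both socles lie in `ker T`, resp. `im T`; `dim ker T + dim im T = dim 𝓑 ≤ p + 1 = (r + 1) + (s + 1)` forces
  equality), so `𝓑(χ₁, χ₂)/soc ≅ soc 𝓑(χ₂, χ₁) = Sym^s ⊗ χ₂∘det` — the second Jordan–Hölder factor;
* **`eq_bot_or_eq_socle_or_eq_top`** — every subrepresentation of `𝓑(χ₁, χ₂)` is `0`, the socle, or everything
  (uniserial of length two: `σ̄(χ)` has exactly the two Jordan–Hölder factors above, the socle occurring once);
  packaged for `χ₂ := χ₁ε^r`, `0 < r < p − 1`, as `eq_bot_or_eq_socle_or_eq_top_of_pos_of_lt`.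

Not here: the split case `χ₁ = χ₂`; `GL₂(𝔽_q)` for `q = p^f`, `f > 1`; an explicit isomorphism of the
quotient MODULE with `Sym^s ⊗ χ₂∘det` (it is `T` itself, by the first isomorphism theorem).
-/

namespace Literature.RepresentationTheory.FiniteGroups

namespace GL2

open Matrix

section Dimension

open MvPolynomial

variable {F : Type} [Field F] [Fintype F] [DecidableEq F] {k : Type*} [Field k] (f : F →+* k)
  (χ₁ χ₂ : Fˣ →* kˣ) (r : ℕ)

/-- `dim 𝓑(χ₁, χ₂) ≤ #F + 1` (`= [G : B] = #ℙ¹(F)`; the `#F + 1` translates of `f₁` span).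
[cite: Bump1997, §4.1 Lemma 4.1.1] -/
theorem finrank_principalSeriesRep_le :
    Module.finrank k (Representation.coindV (borel F).subtype (scalarRep (borelCharacter F χ₁ χ₂))) ≤
      Fintype.card F + 1 := by
  let v : Option F → Representation.coindV (borel F).subtype (scalarRep (borelCharacter F χ₁ χ₂)) :=
    fun o => Option.elim o (principalSeriesRep F χ₁ χ₂ (weyl F) (deltaBorel χ₁ χ₂))
      (fun t => principalSeriesRep F χ₁ χ₂ (lowerUnip F (-t)) (deltaBorel χ₁ χ₂))
  have hv : Submodule.span k (Set.range v) = ⊤ := by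
    rw [eq_top_iff]
    intro g _
    rw [eq_sum_smul_deltaBorel χ₁ χ₂ g]
    refine Submodule.add_mem _ (Submodule.sum_mem _ fun t _ => Submodule.smul_mem _ _ ?_)
      (Submodule.smul_mem _ _ ?_)
    · exact Submodule.subset_span ⟨some t, rfl⟩
    · exact Submodule.subset_span ⟨none, rfl⟩
  have := finrank_le_of_span_eq_top hv
  rwa [Fintype.card_option] at this

omit [Fintype F] [DecidableEq F] in
/-- The exponent vectors `(n − i, i)` of the monomials `X₀^{n−i} X₁^i`, `0 ≤ i ≤ n`, are distinct.
[cite: Humphreys2005, §19.2 p.198] -/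
theorem binaryExponent_injective (n : ℕ) :
    Function.Injective (fun i : Fin (n + 1) => (Finsupp.single 0 (n - (i : ℕ)) + Finsupp.single 1 (i : ℕ) : Fin 2 →₀ ℕ)) := by
  intro i j h
  have := congrArg (fun d : Fin 2 →₀ ℕ => d 1) h
  simp only [Finsupp.coe_add, Pi.add_apply, Finsupp.single_apply] at this
  simp at this
  exact Fin.ext this

omit [Fintype F] [DecidableEq F] in
/-- `deg (X₀^{n−i} X₁^i) = n`. [cite: Humphreys2005, §19.2 p.198] -/
theorem degree_binaryExponent (n : ℕ) (i : Fin (n + 1)) :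
    (Finsupp.single 0 (n - (i : ℕ)) + Finsupp.single 1 (i : ℕ) : Fin 2 →₀ ℕ).degree = n := by
  rw [Finsupp.degree_eq_sum, Fin.sum_univ_two]
  simp only [Finsupp.coe_add, Pi.add_apply, Finsupp.single_apply]
  simp
  omega

omit [Fintype F] [DecidableEq F] in
/-- `X₀^{n−i} X₁^i` is a binary form of degree `n`. [cite: Humphreys2005, §19.2 p.198] -/
theorem monomial_binaryExponent_mem (n : ℕ) (i : Fin (n + 1)) :
    (monomial (Finsupp.single 0 (n - (i : ℕ)) + Finsupp.single 1 (i : ℕ) : Fin 2 →₀ ℕ) (1 : k)) ∈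
      homogeneousSubmodule (Fin 2) k n :=
  (mem_homogeneousSubmodule _ _).mpr (isHomogeneous_monomial _ (degree_binaryExponent n i))

/-- The `n + 1` monomials `X₀^{n−i} X₁^i` are linearly independent binary forms of degree `n`
(so `dim Sym^n ≥ n + 1`). [cite: Humphreys2005, §19.2 p.198] -/
theorem linearIndependent_monomial_binaryExponent (n : ℕ) :
    LinearIndependent k (fun i : Fin (n + 1) =>
      (⟨monomial (Finsupp.single 0 (n - (i : ℕ)) + Finsupp.single 1 (i : ℕ) : Fin 2 →₀ ℕ) (1 : k),
        monomial_binaryExponent_mem n i⟩ : homogeneousSubmodule (Fin 2) k n)) := by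
  refine LinearIndependent.of_comp (homogeneousSubmodule (Fin 2) k n).subtype ?_
  have h := (basisMonomials (Fin 2) k).linearIndependent.comp _ (binaryExponent_injective n)
  simpa [Function.comp_def, coe_basisMonomials] using h

omit [DecidableEq F] in
/-- `dim (Sym^r ⊗ χ₁∘det ⊂ 𝓑(χ₁, χ₂)) ≥ r + 1` for `r < #F` (`Φ` is injective on the `r + 1` monomials).
[cite: EmertonGeeSavitt2015, §3.2] -/
theorem le_finrank_symPowSubrep (hχ : ∀ a : Fˣ, (χ₂ a : k) = (χ₁ a : k) * f a ^ r)
    (hr : r < Fintype.card F) :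
    r + 1 ≤ Module.finrank k (symPowSubrep f χ₁ χ₂ r hχ).toSubmodule := by
  let m : Fin (r + 1) → (symPowSubrep f χ₁ χ₂ r hχ).toSubmodule := fun i =>
    ⟨symPowToPrincipalSeries f χ₁ χ₂ r hχ
        ⟨monomial (Finsupp.single 0 (r - (i : ℕ)) + Finsupp.single 1 (i : ℕ) : Fin 2 →₀ ℕ) (1 : k),
          monomial_binaryExponent_mem r i⟩, ⟨_, rfl⟩⟩
  have hm : LinearIndependent k m := by
    refine LinearIndependent.of_comp (symPowSubrep f χ₁ χ₂ r hχ).toSubmodule.subtype ?_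
    have h := (linearIndependent_monomial_binaryExponent (k := k) r).map'
      (symPowToPrincipalSeries f χ₁ χ₂ r hχ)
      (LinearMap.ker_eq_bot.mpr (symPowToPrincipalSeries_injective hχ hr))
    exact h
  have := hm.fintype_card_le_finrank
  rwa [Fintype.card_fin] at this

end Dimension

section LengthTwo

variable (p : ℕ) [Fact p.Prime] {k : Type*} [Field k] [CharP k p] {χ₁ χ₂ : (ZMod p)ˣ →* kˣ} {r s : ℕ}

/-- The reverse relation: `χ₂ = χ₁ ε^r` and `r + s = p − 1` give `χ₁ = χ₂ ε^s` (`ε^{p−1} = 1` on `𝔽_pˣ`).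
[cite: EmertonGeeSavitt2015, §3.2] -/
theorem rel_symm (hχ : ∀ a : (ZMod p)ˣ, (χ₂ a : k) = (χ₁ a : k) * ZMod.castHom (dvd_refl p) k a ^ r)
    (hrs : r + s = p - 1) :
    ∀ a : (ZMod p)ˣ, (χ₁ a : k) = (χ₂ a : k) * ZMod.castHom (dvd_refl p) k a ^ s := by
  intro a
  rw [hχ a, mul_assoc, ← pow_add, hrs, ← map_pow, ZMod.pow_card_sub_one_eq_one a.ne_zero, map_one, mul_one]

/-- **Dimension count** (`χ₂ = χ₁ε^r`, `r + s = p − 1`, `χ₁ ≠ χ₂`): `dim 𝓑(χ₁, χ₂) = p + 1`,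
`dim (Sym^r ⊗ χ₁∘det) = dim ker T = r + 1`, `dim (Sym^s ⊗ χ₂∘det) = dim im T = s + 1` — from
`dim 𝓑 ≤ p + 1 = (r + 1) + (s + 1)`, rank–nullity for `T`, and the two socle inclusions
`Sym^r ⊗ χ₁∘det ≤ ker T` (`T f_w = 0`), `Sym^s ⊗ χ₂∘det ≤ im T` (`T f₁ = f_w' ≠ 0`). [cite: EmertonGeeSavitt2015, §3.2] -/
theorem finrank_eq_of_rel (hχne : χ₁ ≠ χ₂)
    (hχ : ∀ a : (ZMod p)ˣ, (χ₂ a : k) = (χ₁ a : k) * ZMod.castHom (dvd_refl p) k a ^ r)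
    (hrs : r + s = p - 1) :
    Module.finrank k (Representation.coindV (borel (ZMod p)).subtype
        (scalarRep (borelCharacter (ZMod p) χ₁ χ₂))) = p + 1 ∧
      Module.finrank k (symPowSubrep (ZMod.castHom (dvd_refl p) k) χ₁ χ₂ r hχ).toSubmodule = r + 1 ∧
      Module.finrank k (LinearMap.ker (intertwining χ₁ χ₂)) = r + 1 ∧
      Module.finrank k (symPowSubrep (ZMod.castHom (dvd_refl p) k) χ₂ χ₁ s (rel_symm p hχ hrs)).toSubmodule
        = s + 1 ∧
      Module.finrank k (LinearMap.range (intertwining χ₁ χ₂)) = s + 1 := by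
  have hp : 2 ≤ p := (Fact.out : p.Prime).two_le
  have hr : r < p := by omega
  have hs : s < p := by omega
  have hrF : r < Fintype.card (ZMod p) := by rwa [ZMod.card]
  have hsF : s < Fintype.card (ZMod p) := by rwa [ZMod.card]
  have hF : (Fintype.card (ZMod p) : k) = 0 := by rw [ZMod.card, CharP.cast_eq_zero]
  -- both socles lie in `ker T`, resp. `im T`
  have hker_ne : kerIntertwining χ₁ χ₂ ≠ ⊥ := by
    intro h
    have hmem : deltaBigCell χ₁ χ₂ ∈ kerIntertwining χ₁ χ₂ := by
      change deltaBigCell χ₁ χ₂ ∈ LinearMap.ker (intertwining χ₁ χ₂)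
      rw [LinearMap.mem_ker, intertwining_deltaBigCell χ₁ χ₂ hχne hF]
    rw [h] at hmem
    exact deltaBigCell_ne_zero χ₁ χ₂ hmem
  have hran_ne : rangeIntertwining χ₁ χ₂ ≠ ⊥ := by
    intro h
    have hmem : deltaBigCell χ₂ χ₁ ∈ rangeIntertwining χ₁ χ₂ :=
      ⟨deltaBorel χ₁ χ₂, intertwining_deltaBorel χ₁ χ₂⟩
    rw [h] at hmem
    exact deltaBigCell_ne_zero χ₂ χ₁ hmem
  have h1 : (symPowSubrep (ZMod.castHom (dvd_refl p) k) χ₁ χ₂ r hχ).toSubmodule ≤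
      LinearMap.ker (intertwining χ₁ χ₂) :=
    symPowSubrep_le_of_ne_bot p hχne hχ hr _ hker_ne
  have h2 : (symPowSubrep (ZMod.castHom (dvd_refl p) k) χ₂ χ₁ s (rel_symm p hχ hrs)).toSubmodule ≤
      LinearMap.range (intertwining χ₁ χ₂) :=
    symPowSubrep_le_of_ne_bot p (Ne.symm hχne) (rel_symm p hχ hrs) hs _ hran_ne
  have d1 := le_finrank_symPowSubrep (ZMod.castHom (dvd_refl p) k) χ₁ χ₂ r hχ hrF
  have d2 := le_finrank_symPowSubrep (ZMod.castHom (dvd_refl p) k) χ₂ χ₁ s (rel_symm p hχ hrs) hsF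
  have dV := finrank_principalSeriesRep_le (k := k) χ₁ χ₂ (F := ZMod p)
  rw [ZMod.card] at dV
  have dsum := LinearMap.finrank_range_add_finrank_ker (intertwining χ₁ χ₂)
  have m1 := Submodule.finrank_mono h1
  have m2 := Submodule.finrank_mono h2
  omega

/-- **`ker T = Sym^r ⊗ χ₁∘det` and `im T = Sym^s ⊗ χ₂∘det`** (`χ₂ = χ₁ε^r`, `r + s = p − 1`, `0 < r < p − 1`):
the intertwining operator realises the non-split two-step filtration of the mod-`p` principal series
(the two socle inclusions are equalities by the dimension count `finrank_eq_of_rel`).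
[cite: EmertonGeeSavitt2015, §3.2] -/
theorem ker_and_range_intertwining (hχne : χ₁ ≠ χ₂)
    (hχ : ∀ a : (ZMod p)ˣ, (χ₂ a : k) = (χ₁ a : k) * ZMod.castHom (dvd_refl p) k a ^ r)
    (hrs : r + s = p - 1) :
    LinearMap.ker (intertwining χ₁ χ₂) =
        (symPowSubrep (ZMod.castHom (dvd_refl p) k) χ₁ χ₂ r hχ).toSubmodule ∧
      LinearMap.range (intertwining χ₁ χ₂) =
        (symPowSubrep (ZMod.castHom (dvd_refl p) k) χ₂ χ₁ s (rel_symm p hχ hrs)).toSubmodule := by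
  have hp : 2 ≤ p := (Fact.out : p.Prime).two_le
  have hr : r < p := by omega
  have hs : s < p := by omega
  have hF : (Fintype.card (ZMod p) : k) = 0 := by rw [ZMod.card, CharP.cast_eq_zero]
  obtain ⟨_, dσ, dker, dσ', dran⟩ := finrank_eq_of_rel p hχne hχ hrs
  have hker_ne : kerIntertwining χ₁ χ₂ ≠ ⊥ := by
    intro h
    have hmem : deltaBigCell χ₁ χ₂ ∈ kerIntertwining χ₁ χ₂ := by
      change deltaBigCell χ₁ χ₂ ∈ LinearMap.ker (intertwining χ₁ χ₂)
      rw [LinearMap.mem_ker, intertwining_deltaBigCell χ₁ χ₂ hχne hF]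
    rw [h] at hmem
    exact deltaBigCell_ne_zero χ₁ χ₂ hmem
  have hran_ne : rangeIntertwining χ₁ χ₂ ≠ ⊥ := by
    intro h
    have hmem : deltaBigCell χ₂ χ₁ ∈ rangeIntertwining χ₁ χ₂ :=
      ⟨deltaBorel χ₁ χ₂, intertwining_deltaBorel χ₁ χ₂⟩
    rw [h] at hmem
    exact deltaBigCell_ne_zero χ₂ χ₁ hmem
  have h1 : (symPowSubrep (ZMod.castHom (dvd_refl p) k) χ₁ χ₂ r hχ).toSubmodule ≤
      LinearMap.ker (intertwining χ₁ χ₂) :=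
    symPowSubrep_le_of_ne_bot p hχne hχ hr _ hker_ne
  have h2 : (symPowSubrep (ZMod.castHom (dvd_refl p) k) χ₂ χ₁ s (rel_symm p hχ hrs)).toSubmodule ≤
      LinearMap.range (intertwining χ₁ χ₂) :=
    symPowSubrep_le_of_ne_bot p (Ne.symm hχne) (rel_symm p hχ hrs) hs _ hran_ne
  exact ⟨(Submodule.eq_of_le_of_finrank_le h1 (by omega)).symm,
    (Submodule.eq_of_le_of_finrank_le h2 (by omega)).symm⟩

/-- **The mod-`p` principal series `Ind_B^{GL₂(𝔽_p)}(χ₁ ⊗ χ₁ε^r)`, `0 < r < p − 1`, is uniserial of length two**: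
its only subrepresentations are `0`, the socle `Sym^r ⊗ χ₁∘det`, and everything; the quotient by the socle
is `im T ≅ Sym^{p−1−r} ⊗ χ₂∘det`, the socle of `𝓑(χ₂, χ₁)` (Jordan–Hölder factors `σ̄(χ)_∅`, `σ̄(χ)_{{0}}`).
[cite: EmertonGeeSavitt2015, §3.2] -/
theorem eq_bot_or_eq_socle_or_eq_top (hχne : χ₁ ≠ χ₂)
    (hχ : ∀ a : (ZMod p)ˣ, (χ₂ a : k) = (χ₁ a : k) * ZMod.castHom (dvd_refl p) k a ^ r)
    (hrs : r + s = p - 1) (S : Subrepresentation (principalSeriesRep (ZMod p) χ₁ χ₂)) :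
    S = ⊥ ∨ S = symPowSubrep (ZMod.castHom (dvd_refl p) k) χ₁ χ₂ r hχ ∨ S = ⊤ := by
  have hp : 2 ≤ p := (Fact.out : p.Prime).two_le
  have hr : r < p := by omega
  have hs : s < p := by omega
  obtain ⟨hker, hran⟩ := ker_and_range_intertwining p hχne hχ hrs
  by_cases hS : S = ⊥
  · exact Or.inl hS
  right
  have hsoc : symPowSubrep (ZMod.castHom (dvd_refl p) k) χ₁ χ₂ r hχ ≤ S :=
    symPowSubrep_le_of_ne_bot p hχne hχ hr S hS
  -- the image of `S` under `T`
  let S' : Subrepresentation (principalSeriesRep (ZMod p) χ₂ χ₁) :=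
    ⟨S.toSubmodule.map (intertwining χ₁ χ₂), by
      rintro h _ ⟨v, hv, rfl⟩
      exact ⟨_, S.apply_mem_toSubmodule h hv, intertwining_principalSeriesRep χ₁ χ₂ h v⟩⟩
  by_cases hS' : S' = ⊥
  · -- `T(S) = 0`: `S ≤ ker T = socle`
    left
    refine le_antisymm ?_ hsoc
    intro v hv
    change v ∈ (symPowSubrep (ZMod.castHom (dvd_refl p) k) χ₁ χ₂ r hχ).toSubmodule
    rw [← hker, LinearMap.mem_ker]
    have : intertwining χ₁ χ₂ v ∈ S' := ⟨v, hv, rfl⟩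
    rw [hS'] at this
    exact this
  · -- `T(S) ⊇ socle' = im T`, so `S + ker T = ⊤`, and `ker T = socle ≤ S`
    right
    have hsoc' : symPowSubrep (ZMod.castHom (dvd_refl p) k) χ₂ χ₁ s (rel_symm p hχ hrs) ≤ S' :=
      symPowSubrep_le_of_ne_bot p (Ne.symm hχne) (rel_symm p hχ hrs) hs S' hS'
    refine Subrepresentation.toSubmodule_injective (eq_top_iff.mpr fun v _ => ?_)
    have hv : intertwining χ₁ χ₂ v ∈ S'.toSubmodule := by
      apply hsoc'
      change intertwining χ₁ χ₂ v ∈ (symPowSubrep (ZMod.castHom (dvd_refl p) k) χ₂ χ₁ s _).toSubmodule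
      rw [← hran]
      exact LinearMap.mem_range_self _ _
    obtain ⟨u, hu, huv⟩ := hv
    have hdiff : v - u ∈ (symPowSubrep (ZMod.castHom (dvd_refl p) k) χ₁ χ₂ r hχ).toSubmodule := by
      rw [← hker, LinearMap.mem_ker, map_sub, huv, sub_self]
    have := S.toSubmodule.add_mem (hsoc hdiff) hu
    rwa [sub_add_cancel] at this

/-- The packaged form for `χ₂ := χ₁ ε^r`, `0 < r < p − 1`. [cite: EmertonGeeSavitt2015, §3.2] -/
theorem eq_bot_or_eq_socle_or_eq_top_of_pos_of_lt (χ₁ : (ZMod p)ˣ →* kˣ) {r : ℕ} (h0 : 0 < r) (hr : r < p - 1)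
    (S : Subrepresentation (principalSeriesRep (ZMod p) χ₁
      (χ₁ * Units.map ((ZMod.castHom (dvd_refl p) k).toMonoidHom) ^ r))) :
    S = ⊥ ∨ S = symPowSubrep (ZMod.castHom (dvd_refl p) k) χ₁
        (χ₁ * Units.map ((ZMod.castHom (dvd_refl p) k).toMonoidHom) ^ r) r
        (coe_mul_pow_unitsMap_castHom_apply p χ₁ r) ∨ S = ⊤ :=
  eq_bot_or_eq_socle_or_eq_top p (s := p - 1 - r) (ne_mul_pow_unitsMap_castHom p χ₁ h0 hr)
    (coe_mul_pow_unitsMap_castHom_apply p χ₁ r) (by omega) S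

end LengthTwo

end GL2

end Literature.RepresentationTheory.FiniteGroups
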